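import Summits.CriticalPhenomena.CardyFormulaZ2.Theorems.CardyFlipRussoVoronoiHubFromSmirnovStubMeasurableCrossEventContinuum
import Literature.Topology.PlaneTopology.JordanDomainLocalJoin
import HarnessLib

/-!
# The strict and the dual (white) Voronoi crossing events are measurable (stub `stub_measurableCrossEvent`, part 3)

Helper file `--supports stmt-CriticalPhenomena-6433` (line `moebius-exact-delaunay-dilation-ward`,
stub S0 `stub_measurableCrossEvent` of the crux `VoronoiHubFromSmirnov`).  Companion of
`…StubMeasurableCrossEventContinuum.lean`: for the RELATIVELY OPEN regions of `closure Ω`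
(`d₁(z) = infDist (z/δ) c.1`, `d₂(z) = infDist (z/δ) c.2`)

* the strictly black points `closure Ω ∩ {d₁ < d₂}` and
* the strictly white points `closure Ω ∩ {d₂ < d₁}` (the complement in `closure Ω` of the closed black
  region `{d₁ ≤ d₂}` of the crux — the DUAL region),

path crossings and continuum crossings coincide, because `closure Ω` is uniformly locally path
connected (Schoenflies, `Literature.Topology.PlaneTopology.exists_joinedIn_closure_ball`) and so are
its relatively open subsets; a compact path in `{d₁ < d₂}` lies in `{d₁ + 1/(n+1) ≤ d₂}` for some `n`.
Hence the PATH crossing events of these open regions between any two boundary arcs are countable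
unions of continuum crossing events of compact random sets with measurable hitting events
(`measurableSet_exists_isPreconnected`), and are measurable:

* `measurableSet_inter_setOf_infDist_add_le_nonempty` — hitting events of `{d₁ + s ≤ d₂}`, `s ∈ ℝ`;
* `joinedIn_inter_of_isPreconnected` — points of a connected subset of `closure Ω ∩ U`, `U` open,
  are joined by paths in `closure Ω ∩ U`;
* `strictCross_iff_exists_isPreconnected` — path crossing of `closure Ω ∩ {d₁ < d₂}` iff for some `n`
  a connected subset of `closure Ω ∩ {d₁ + 1/(n+1) ≤ d₂}` meets both arcs;
* `measurableSet_strictCrossEvent`, `measurableSet_dualCrossEvent` — measurability of the strict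
  black and of the strict white (dual) path crossing events between `R.arc i` and `R.arc j`.

The crux's own event uses the CLOSED black region (ties black), for which "continuum ⇒ path" is the
remaining plane-topological obligation isolated in `measurableSet_crossEvent_of_joined`; the events of
this file sandwich it: strict black crossing `⊆ crossEvent R δ ⊆` continuum crossing.
-/

noncomputable section

namespace Summit.CriticalPhenomena.CardyFormulaZ2.Cruxes.VoronoiHubFromSmirnov.MoebiusExactDelaunayDilationWard

open scoped Topology
open Set MeasureTheory Metric Filter
open Literature.Analysis.FunctionSpaces
open Literature.Probability.RandomPlanarGeometry
open Literature.Topology.PlaneTopology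

/-- **Hitting events of the shifted black regions are measurable.** For every compact `F`, mesh `δ`
and shift `s`, the event that `F` meets `{z | infDist (z/δ) c.1 + s ≤ infDist (z/δ) c.2}` is
measurable (`s = 0`: the closed black region; `s > 0`: compact exhaustion of the strictly black
points).  Same proof as `measurableSet_blackRegion_inter_nonempty`. -/
theorem measurableSet_inter_setOf_infDist_add_le_nonempty : ∀ (F : Set ℂ), IsCompact F → ∀ (δ s : ℝ), MeasurableSet {c : PointConfig ℂ × PointConfig ℂ | (F ∩ {z | Metric.infDist (z / (δ : ℂ)) (c.1 : Set ℂ) + s ≤ Metric.infDist (z / (δ : ℂ)) (c.2 : Set ℂ)}).Nonempty} := by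
  intro F hF δ s
  rcases F.eq_empty_or_nonempty with rfl | hFne
  · simp only [empty_inter, Set.not_nonempty_empty, setOf_false, MeasurableSet.empty]
  obtain ⟨D, hDF, hDc, hFD⟩ :=
    (TopologicalSpace.IsSeparable.of_separableSpace F).exists_countable_dense_subset
  have key : {c : PointConfig ℂ × PointConfig ℂ | (F ∩ {z | infDist (z / (δ : ℂ)) (c.1 : Set ℂ) + s ≤
        infDist (z / (δ : ℂ)) (c.2 : Set ℂ)}).Nonempty} =
      ⋂ n : ℕ, ⋃ d ∈ D, {c : PointConfig ℂ × PointConfig ℂ |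
        infDist (d / (δ : ℂ)) (c.1 : Set ℂ) - infDist (d / (δ : ℂ)) (c.2 : Set ℂ) <
          -s + 1 / ((n : ℝ) + 1)} := by
    ext c
    simp only [mem_setOf_eq, mem_iInter, mem_iUnion, exists_prop]
    obtain ⟨z₀, hz₀F, hz₀⟩ := hF.exists_isMinOn hFne (continuous_infDist_div_sub δ c).continuousOn
    constructor
    · rintro ⟨z, hzF, hz⟩ n
      have hpos : (0 : ℝ) < 1 / ((n : ℝ) + 1) := Nat.one_div_pos_of_nat
      obtain ⟨η, hη, hηg⟩ :=
        Metric.continuousAt_iff.1 (continuous_infDist_div_sub δ c).continuousAt _ hpos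
      obtain ⟨d, hdD, hzd⟩ := Metric.mem_closure_iff.1 (hFD hzF) η hη
      refine ⟨d, hdD, ?_⟩
      have h1 := hηg (show dist d z < η by rwa [dist_comm])
      rw [Real.dist_eq] at h1
      have h2 : infDist (z / (δ : ℂ)) (c.1 : Set ℂ) - infDist (z / (δ : ℂ)) (c.2 : Set ℂ) ≤ -s := by
        rw [mem_setOf_eq] at hz
        linarith
      linarith [(abs_lt.1 h1).2]
    · intro h
      refine ⟨z₀, hz₀F, ?_⟩
      rw [mem_setOf_eq]
      by_contra hlt
      push Not at hlt
      obtain ⟨n, hn⟩ := exists_nat_one_div_lt (show (0 : ℝ) < infDist (z₀ / (δ : ℂ)) (c.1 : Set ℂ) -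
        infDist (z₀ / (δ : ℂ)) (c.2 : Set ℂ) + s by linarith)
      obtain ⟨d, hdD, hd⟩ := h n
      have hmin := hz₀ (hDF hdD)
      rw [mem_setOf_eq] at hmin
      linarith
  rw [key]
  exact MeasurableSet.iInter fun n => MeasurableSet.biUnion hDc fun d _ =>
    measurableSet_lt (measurable_infDist_div_sub δ d) measurable_const

/-- **Relatively open subsets of `closure Ω` are locally path connected**: if `C` is a preconnected
subset of `closure Ω ∩ U` with `U` open, then any two points of `C` are joined by a path inside
`closure Ω ∩ U` (uniform local path-connectedness of the closed Jordan domain `closure Ω`,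
`exists_joinedIn_closure_ball`, and `IsPreconnected.induction₂'`). -/
theorem joinedIn_inter_of_isPreconnected (Ω : JordanDomain) {U C : Set ℂ} (hU : IsOpen U)
    (hC : IsPreconnected C) (hCU : C ⊆ closure Ω.carrier ∩ U) {x y : ℂ} (hx : x ∈ C) (hy : y ∈ C) :
    JoinedIn (closure Ω.carrier ∩ U) x y := by
  refine hC.induction₂' (fun x y => JoinedIn (closure Ω.carrier ∩ U) x y) ?_ ?_ hx hy
  · intro x hx
    obtain ⟨ε, hε, hεU⟩ := Metric.isOpen_iff.1 hU x (hCU hx).2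
    obtain ⟨η, hη, hηj⟩ := exists_joinedIn_closure_ball Ω hε
    filter_upwards [inter_mem_nhdsWithin C (ball_mem_nhds x hη)] with y hy
    have hj : JoinedIn (closure Ω.carrier ∩ U) x y :=
      (hηj x (hCU hx).1 y (hCU hy.1).1 (mem_ball'.1 hy.2)).mono (inter_subset_inter_right _ hεU)
    exact ⟨hj, hj.symm⟩
  · intro x y z _ _ _ hxy hyz
    exact hxy.trans hyz

/-- **Strict crossings: paths versus continua.** For the strictly black points
`closure Ω ∩ {d₁ < d₂}` of a conformal rectangle at mesh `δ`, a PATH inside them from `A` to `A'`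
exists iff for some `n` a CONNECTED subset of the compact set `closure Ω ∩ {d₁ + 1/(n+1) ≤ d₂}` meets
`A` and `A'` (a compact path keeps a positive margin `d₂ - d₁ ≥ 1/(n+1)`; conversely connected subsets of
the relatively open region are joined by paths, `joinedIn_inter_of_isPreconnected`). -/
theorem strictCross_iff_exists_isPreconnected (Ω : JordanDomain) (A A' : Set ℂ) (δ : ℝ)
    (c : PointConfig ℂ × PointConfig ℂ) :
    (∃ x ∈ A, ∃ y ∈ A', JoinedIn (closure Ω.carrier ∩
      {z | infDist (z / (δ : ℂ)) (c.1 : Set ℂ) < infDist (z / (δ : ℂ)) (c.2 : Set ℂ)}) x y) ↔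
    ∃ n : ℕ, ∃ C ⊆ closure Ω.carrier ∩ {z | infDist (z / (δ : ℂ)) (c.1 : Set ℂ) + 1 / ((n : ℝ) + 1) ≤
      infDist (z / (δ : ℂ)) (c.2 : Set ℂ)}, IsPreconnected C ∧ (C ∩ A).Nonempty ∧ (C ∩ A').Nonempty := by
  constructor
  · rintro ⟨x, hx, y, hy, γ, hγ⟩
    -- the margin `d₂ - d₁` is positive on the compact range of `γ`
    have hne : (range γ).Nonempty := range_nonempty γ
    obtain ⟨z₀, ⟨t₀, rfl⟩, hz₀⟩ := (isCompact_range γ.continuous).exists_isMaxOn hne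
      (continuous_infDist_div_sub δ c).continuousOn
    have hneg : infDist (γ t₀ / (δ : ℂ)) (c.1 : Set ℂ) - infDist (γ t₀ / (δ : ℂ)) (c.2 : Set ℂ) < 0 := by
      have := (hγ t₀).2
      rw [mem_setOf_eq] at this
      linarith
    obtain ⟨n, hn⟩ := exists_nat_one_div_lt (neg_pos.2 hneg)
    refine ⟨n, range γ, fun z hz => ⟨?_, ?_⟩, isPreconnected_range γ.continuous,
      ⟨x, ⟨0, γ.source⟩, hx⟩, ⟨y, ⟨1, γ.target⟩, hy⟩⟩
    · obtain ⟨t, rfl⟩ := hz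
      exact (hγ t).1
    · have hmax := hz₀ hz
      rw [mem_setOf_eq] at hmax ⊢
      linarith
  · rintro ⟨n, C, hCK, hC, ⟨x, hxC, hxA⟩, ⟨y, hyC, hyA'⟩⟩
    refine ⟨x, hxA, y, hyA', ?_⟩
    have hU : IsOpen {z : ℂ | infDist (z / (δ : ℂ)) (c.1 : Set ℂ) < infDist (z / (δ : ℂ)) (c.2 : Set ℂ)} :=
      isOpen_lt ((continuous_infDist_pt _).comp (continuous_id.div_const _))
        ((continuous_infDist_pt _).comp (continuous_id.div_const _))
    refine joinedIn_inter_of_isPreconnected Ω hU hC (fun z hz => ⟨(hCK hz).1, ?_⟩) hxC hyC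
    have h2 := (hCK hz).2
    rw [mem_setOf_eq] at h2 ⊢
    linarith [(Nat.one_div_pos_of_nat : (0 : ℝ) < 1 / ((n : ℝ) + 1))]

/-- **The strict black crossing event is measurable**: for every conformal rectangle `R`, mesh `δ` and
pair of arcs `R.arc i`, `R.arc j`, the event that some point of `R.arc i` is joined to some point of
`R.arc j` by a path of STRICTLY black points of `closure Ω` (`infDist (z/δ) c.1 < infDist (z/δ) c.2`)
is measurable in the product of the count σ-algebras. -/
theorem measurableSet_strictCrossEvent : ∀ (R : ConformalRectangle) (δ : ℝ) (i j : Fin 4), MeasurableSet {c : PointConfig ℂ × PointConfig ℂ | ∃ x ∈ R.arc i, ∃ y ∈ R.arc j, JoinedIn (closure R.carrier ∩ {z | Metric.infDist (z / (δ : ℂ)) (c.1 : Set ℂ) < Metric.infDist (z / (δ : ℂ)) (c.2 : Set ℂ)}) x y} := by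
  intro R δ i j
  have hset : {c : PointConfig ℂ × PointConfig ℂ | ∃ x ∈ R.arc i, ∃ y ∈ R.arc j,
      JoinedIn (closure R.carrier ∩ {z | Metric.infDist (z / (δ : ℂ)) (c.1 : Set ℂ) <
        Metric.infDist (z / (δ : ℂ)) (c.2 : Set ℂ)}) x y} =
      ⋃ n : ℕ, {c : PointConfig ℂ × PointConfig ℂ | ∃ C ⊆ closure R.carrier ∩
        {z | infDist (z / (δ : ℂ)) (c.1 : Set ℂ) + 1 / ((n : ℝ) + 1) ≤ infDist (z / (δ : ℂ)) (c.2 : Set ℂ)},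
        IsPreconnected C ∧ (C ∩ R.arc i).Nonempty ∧ (C ∩ R.arc j).Nonempty} := by
    ext c
    simp only [mem_setOf_eq, mem_iUnion]
    exact strictCross_iff_exists_isPreconnected R.toJordanDomain (R.arc i) (R.arc j) δ c
  rw [hset]
  refine MeasurableSet.iUnion fun n => ?_
  have hcl : ∀ c : PointConfig ℂ × PointConfig ℂ, IsClosed {z : ℂ | infDist (z / (δ : ℂ)) (c.1 : Set ℂ) +
      1 / ((n : ℝ) + 1) ≤ infDist (z / (δ : ℂ)) (c.2 : Set ℂ)} := fun c =>
    isClosed_le (((continuous_infDist_pt _).comp (continuous_id.div_const _)).add continuous_const)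
      ((continuous_infDist_pt _).comp (continuous_id.div_const _))
  refine measurableSet_exists_isPreconnected
    (fun c : PointConfig ℂ × PointConfig ℂ => closure R.carrier ∩
      {z | infDist (z / (δ : ℂ)) (c.1 : Set ℂ) + 1 / ((n : ℝ) + 1) ≤ infDist (z / (δ : ℂ)) (c.2 : Set ℂ)})
    (fun c => R.isBounded.isCompact_closure.inter_right (hcl c)) (fun F hF => ?_)
    (R.isClosed_arc i) (R.isClosed_arc j)
  have : ∀ c : PointConfig ℂ × PointConfig ℂ, F ∩ (closure R.carrier ∩
      {z | infDist (z / (δ : ℂ)) (c.1 : Set ℂ) + 1 / ((n : ℝ) + 1) ≤ infDist (z / (δ : ℂ)) (c.2 : Set ℂ)}) =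
      (F ∩ closure R.carrier) ∩
        {z | infDist (z / (δ : ℂ)) (c.1 : Set ℂ) + 1 / ((n : ℝ) + 1) ≤ infDist (z / (δ : ℂ)) (c.2 : Set ℂ)} :=
    fun c => (inter_assoc _ _ _).symm
  simp_rw [this]
  exact measurableSet_inter_setOf_infDist_add_le_nonempty _ (hF.inter_right isClosed_closure) δ _

/-- **The dual (strict white) crossing event is measurable**: for every conformal rectangle `R`, mesh
`δ` and arcs `R.arc i`, `R.arc j`, the event that some point of `R.arc i` is joined to some point of
`R.arc j` by a path inside `closure Ω` of STRICTLY white points (`infDist (z/δ) c.2 < infDist (z/δ) c.1`,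
the complement of the crux's closed black region) is measurable (colour swap `c ↦ (c.2, c.1)` is
measurable). -/
theorem measurableSet_dualCrossEvent : ∀ (R : ConformalRectangle) (δ : ℝ) (i j : Fin 4), MeasurableSet {c : PointConfig ℂ × PointConfig ℂ | ∃ x ∈ R.arc i, ∃ y ∈ R.arc j, JoinedIn (closure R.carrier ∩ {z | Metric.infDist (z / (δ : ℂ)) (c.2 : Set ℂ) < Metric.infDist (z / (δ : ℂ)) (c.1 : Set ℂ)}) x y} := by
  intro R δ i j
  have hset : {c : PointConfig ℂ × PointConfig ℂ | ∃ x ∈ R.arc i, ∃ y ∈ R.arc j,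
      JoinedIn (closure R.carrier ∩ {z | Metric.infDist (z / (δ : ℂ)) (c.2 : Set ℂ) <
        Metric.infDist (z / (δ : ℂ)) (c.1 : Set ℂ)}) x y} =
      Prod.swap ⁻¹' {c : PointConfig ℂ × PointConfig ℂ | ∃ x ∈ R.arc i, ∃ y ∈ R.arc j,
        JoinedIn (closure R.carrier ∩ {z | Metric.infDist (z / (δ : ℂ)) (c.1 : Set ℂ) <
          Metric.infDist (z / (δ : ℂ)) (c.2 : Set ℂ)}) x y} :=
    Set.ext fun _ => Iff.rfl
  rw [hset]
  exact (measurableSet_strictCrossEvent R δ i j).preimage measurable_swap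

end Summit.CriticalPhenomena.CardyFormulaZ2.Cruxes.VoronoiHubFromSmirnov.MoebiusExactDelaunayDilationWard

end
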